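import Mathlib
import Summits.Ventures.HodgeRepro2.T6N5LocalDatum
import Summits.Ventures.HodgeRepro2.T6N5Local
import Summits.Ventures.HodgeRepro2.T6N5LocalHypSmooth
import Summits.Ventures.HodgeRepro2.T6N5LocalWeilQuotient
import Summits.Ventures.HodgeRepro2.T6N5LocalWeilQuotientSmooth
import Summits.Ventures.HodgeRepro2.T6N5LocalInertToyEps
import Summits.Ventures.HodgeRepro2.T6N5LocalRamToyEps
import Summits.Ventures.HodgeRepro2.T6N5Rich
import Summits.Ventures.HodgeRepro2.T6N5RealPlace
import Summits.Ventures.HodgeRepro2.T6N5RichToyData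

/-!
# T6N5LocalSignModel — Tier 6, M2 sub-step N5 (t6-p8's half): THE SIGN MODEL OF A FAMILY OF PLACES — the
residual binders `hsol : R5.S.Solves` and `hre : R5.S.RealCondB` of `HCCMOfPublished₂` (ledger rows 183–184)
as THEOREMS of a sign model built from the per-place statements of record v2

The M2-final `HCCMOfPublished₂` (T6MainM2Stmt) assumes, for the rich N5 datum `R5 : N5Rich.RichData M.ι5 M.G5`
of the N side, that its sign model `R5.S` has characters solving the coupled local system of Theorem N5.T2 at
every finite non-split place (`hsol`) and satisfies condition (b) at the real places (`hre`).  This file builds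
the sign model that a continuation needs for these two rows, on ANY index type of places:
* `LocalInput v w` — the objects the per-place statements of record v2
  (`N5LocalWeilQuotientSmooth.N5Local_main_inert_completion_weil''` / `_ram_completion_weil''`) quantify over at one
  finite place `v` of `K` with `w | v` non-split in `L`: the place data (inert or ramified — `InertPlace v w`
  / `RamPlace v w`), Tate's ε-factor parameter `P`, the datum's `ψ_δ` (trivial on `K_v`), and the carried Weil
  representation `R` of the two hermitian lines, non-zero;
* `LocalInput.D` — the local sign datum of the statement of record at the place; `LocalInput.Hyps` — EXACTLY the
  remaining hypotheses of that statement (the displays `GGP2012ex_Prop3_1` / `Tate1979_3_2_2_3` (inert) or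
  `Tate1979_3_2_6_3` / `GGP2012_Prop5_1_2` (ramified) and `BFGYYZ2025_Thm3_5_smooth`, the Weil carrier's
  finite-index and open smoothness, `ϵ_δ(W) = 1`, `χ_W` conjugate-symplectic); `LocalInput.exists_localSolution` —
  the coupled local system is solved at the place (the statements of record, with the inert binder
  «inertia degree ≥ 2» a theorem, `InertPlace.hf`);
* `PlaceFamily ι` — the places of the N side by kind (t6-p7's `PlaceKind`), with a finite non-split place of `K`
  in `L` and its local input behind every place of kind `ns`; `PlaceFamily.D` the local sign datum at each place
  (the toy datum where the sign model does not read it — split and real places); `PlaceFamily.Hyps` — the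
  per-place hypotheses at every finite non-split place;
* `PlaceFamily.signModel` — THE SIGN MODEL: the (D-ξ) choice of TIER5 §N5.11 made by `Classical.choose` on the
  per-place solutions, the real-place signs those of t6-p7's real data (`N5RealPlace.SignModel.ofReal`);
  `signModel_solves` (= `hsol`) from `PlaceFamily.Hyps`; `signModel_realCondB` (= `hre`) from t6-p7's real-place
  hypotheses (`N5RealPlace.realCondB_ofReal`); `solves_and_realCondB` both at once; `solves_realCondB_of_eq` —
  for any rich datum whose sign model is this one, `hsol` and `hre` hold.
Nothing here is a display (no `[cite:` docstring) and nothing automorphic is constructed: the module is the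
TRANSFER of the per-place theorems to the shape of the two residual binders.  What a continuation still supplies
on the host datum is the place family itself — `M.ι5` with its kinds and, at every finite non-split place, the
input `(P, ψ_δ, R)` with `Hyps` (the displays are published statements consumed by name; the rest are properties
of the local datum) — and, at the real places, t6-p7's data.  Count-neutral; nothing of the scored record changes.
README §8(d): uses an L-value-free non-vanishing device: NO.
-/

namespace Summit.Ventures.HodgeRepro2.T6.N5LocalSignModel

open Summit.Ventures.HodgeRepro2 IsDedekindDomain HeightOneSpectrum
  Summit.Ventures.HodgeRepro2.T6.N5LocalDatum Summit.Ventures.HodgeRepro2.T6.N5Local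
  Summit.Ventures.HodgeRepro2.T6.Hyp Summit.Ventures.HodgeRepro2.T6.N5LocalTateChars
  Summit.Ventures.HodgeRepro2.T6.N5LocalWeilQuotient Summit.Ventures.HodgeRepro2.T6.N5LocalWeilQuotientSmooth
  Summit.Ventures.HodgeRepro2.T6.N5LocalOnCompletionWeil Summit.Ventures.HodgeRepro2.T6.N5LocalInertToyEps
  Summit.Ventures.HodgeRepro2.T6.N5LocalRamToyEps Summit.Ventures.HodgeRepro2.T6.N5Rich
  Summit.Ventures.HodgeRepro2.T6.N5RealPlace

noncomputable section

/-! ### The local input at one finite non-split place -/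

section Place

-- `K`, `L` in `Type` (universe `0`), as in the statements of record.
variable {K : Type} [Field K] [NumberField K] (v : HeightOneSpectrum (NumberField.RingOfIntegers K))
  {L : Type} [Field L] [NumberField L] [Algebra K L] (w : HeightOneSpectrum (NumberField.RingOfIntegers L))
  [w.asIdeal.LiesOver v.asIdeal]

/-- THE LOCAL INPUT of the N side at a finite place `v` of `K` with `w | v` non-split in `L`: the place data
(inert or ramified), Tate's ε-factor parameter `P` (`T6N5LocalTateChars.TateParams`), the datum's `ψ_δ` trivial
on `K_v`, and the carried Weil representation `R` of the two hermitian lines over `U(V) = E_v^×/F_v^×`, non-zero.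
Data only (the objects the statements of record v2 quantify over). -/
structure LocalInput where
  /-- the place data: inert (`InertPlace`) or ramified (`RamPlace`) -/
  place : InertPlace v w ⊕ RamPlace v w
  /-- Tate's ε-factor parameter -/
  P : TateParams (w.adicCompletion L)ˣ (PsiC w) ℝ
  /-- the datum's additive character `ψ_δ` of `L_w` -/
  ψδ : PsiC w
  /-- … trivial on `K_v` -/
  hK : ∀ a : v.adicCompletion K, ψδ.1 (algebraMap (v.adicCompletion K) (w.adicCompletion L) a) = 1
  /-- the carried Weil representation of the two hermitian lines -/
  R : WeilRep v w
  /-- … non-zero for both signs -/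
  nontriv : ∀ s, Nontrivial (R.Wsp s)

namespace LocalInput

variable {v w} (X : LocalInput v w)

/-- The local sign datum of the inert statement of record at the place. -/
abbrev inertDatum (Q : InertPlace v w) : LocalSignDatum :=
  (mkInertWeil v w Q.h2 Q.hϖ Q.hϖS Q.σ Q.hσ X.P X.ψδ X.hK (toCarrier v w X.R)).toWeil.toLocalSignDatum

/-- The local sign datum of the ramified statement of record at the place. -/
abbrev ramDatum (Q : RamPlace v w) : LocalSignDatum :=
  (mkRamWeil v w Q.h2 Q.hπ Q.σ Q.hσ X.P X.ψδ (toCarrier v w X.R)).toWeil.toLocalSignDatum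

/-- THE LOCAL SIGN DATUM of the statement of record v2 at the place (inert or ramified). -/
def D : LocalSignDatum := Sum.elim X.inertDatum X.ramDatum X.place

/-- The hypotheses of the INERT statement of record v2 (`N5Local_main_inert_completion_weil''`) besides the place
data and the input: the displays `GGP2012ex_Prop3_1`, `Tate1979_3_2_2_3`, `BFGYYZ2025_Thm3_5_smooth` (on the
print's characters), the Weil carrier's finite-index and open smoothness, `ϵ_δ(W) = 1`, `χ_W` conjugate-symplectic. -/
def InertHyps (Q : InertPlace v w) : Prop :=
  GGP2012ex_Prop3_1 (mkInertWeil v w Q.h2 Q.hϖ Q.hϖS Q.σ Q.hσ X.P X.ψδ X.hK (toCarrier v w X.R)).D ∧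
  Tate1979_3_2_2_3 X.P.epsT (fun ξ a => ((ξ a : ℂˣ) : ℂ)) (twist w) (fun r m => r * m) (nrm w)
    (fun _ => True) ∧
  BFGYYZ2025_Thm3_5_smooth (X.inertDatum Q)
    (mkInertWeil v w Q.h2 Q.hϖ Q.hϖS Q.σ Q.hσ X.P X.ψδ X.hK (toCarrier v w X.R)).D.IsSmooth ∧
  (∀ s, (mkInertWeil v w Q.h2 Q.hϖ Q.hϖS Q.σ Q.hσ X.P X.ψδ X.hK (toCarrier v w X.R)).toWeil.IsSmoothCompact s) ∧
  (∀ s, IsSmoothOpenQ v w X.R (N5LocalInertCompletion.U v w Q.ϖ) s) ∧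
  X.P.epsdW = 1 ∧
  (X.inertDatum Q).IsCS X.P.χW

/-- The hypotheses of the RAMIFIED statement of record v2 (`N5Local_main_ram_completion_weil''`) besides the place
data and the input: the displays `Tate1979_3_2_6_3`, `GGP2012_Prop5_1_2`, `BFGYYZ2025_Thm3_5_smooth`, the Weil
carrier's finite-index and open smoothness, `ϵ_δ(W) = 1`, `χ_W` conjugate-symplectic. -/
def RamHyps (Q : RamPlace v w) : Prop :=
  Tate1979_3_2_6_3 (mkRamWeil v w Q.h2 Q.hπ Q.σ Q.hσ X.P X.ψδ (toCarrier v w X.R)).D ∧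
  GGP2012_Prop5_1_2 (mkRamWeil v w Q.h2 Q.hπ Q.σ Q.hσ X.P X.ψδ (toCarrier v w X.R)).D ∧
  BFGYYZ2025_Thm3_5_smooth (X.ramDatum Q)
    (mkRamWeil v w Q.h2 Q.hπ Q.σ Q.hσ X.P X.ψδ (toCarrier v w X.R)).D.IsSmooth ∧
  (∀ s, (mkRamWeil v w Q.h2 Q.hπ Q.σ Q.hσ X.P X.ψδ (toCarrier v w X.R)).toWeil.IsSmoothCompact s) ∧
  (∀ s, IsSmoothOpenQ v w X.R (N5LocalRamCompletion.Uπ w Q.π) s) ∧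
  X.P.epsdW = 1 ∧
  (X.ramDatum Q).IsCS X.P.χW

/-- THE HYPOTHESES OF THE STATEMENT OF RECORD v2 at the place, by the kind of the place data. -/
def Hyps : Prop := Sum.elim X.InertHyps X.RamHyps X.place

/-- The local sign datum at an inert place. -/
theorem D_inl {Q : InertPlace v w} (h : X.place = Sum.inl Q) : X.D = X.inertDatum Q := by
  rw [D, h, Sum.elim_inl]

/-- The local sign datum at a ramified place. -/
theorem D_inr {Q : RamPlace v w} (h : X.place = Sum.inr Q) : X.D = X.ramDatum Q := by
  rw [D, h, Sum.elim_inr]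

/-- THEOREM N5.T2 AT THE PLACE, from the input and the hypotheses of the statement of record v2: the coupled local
system is solved (`N5Local_main_inert_completion_weil''` at an inert place — its binder «inertia degree ≥ 2» is
the theorem `InertPlace.hf` — and `N5Local_main_ram_completion_weil''` at a ramified place). -/
theorem exists_localSolution (h : X.Hyps) : ∃ ξ : Fin 4 → X.D.Char, LocalSolution X.D ξ := by
  haveI := X.nontriv
  rcases hp : X.place with Q | Q
  · have h' : X.InertHyps Q := by
      have := h
      unfold Hyps at this
      rwa [hp, Sum.elim_inl] at this
    obtain ⟨hG, hT, h35, hsm, hsmU, hW, hχW⟩ := h'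
    rw [X.D_inl hp]
    exact N5Local_main_inert_completion_weil'' v w Q.h2 Q.hϖ Q.hϖS Q.σ Q.hσ X.P X.ψδ X.hK X.R Q.hf hG hT h35
      hsm hsmU hW hχW
  · have h' : X.RamHyps Q := by
      have := h
      unfold Hyps at this
      rwa [hp, Sum.elim_inr] at this
    obtain ⟨hT6, hG, h35, hsm, hsmU, hW, hχW⟩ := h'
    rw [X.D_inr hp]
    exact N5Local_main_ram_completion_weil'' v w Q.h2 Q.hϖ Q.hπ Q.hram Q.σ Q.hσ X.P X.ψδ X.R X.hK hT6 hG h35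
      hsm hsmU hW hχW

end LocalInput

end Place

/-! ### A finite non-split place with its input, and a family of places -/

section Family

variable (K : Type) [Field K] [NumberField K] (L : Type) [Field L] [NumberField L] [Algebra K L]

/-- A FINITE NON-SPLIT PLACE of `K` in `L` with the local input of the N side there: the place `v` of `K`, a place
`w` of `L` above it (the completion instances follow from `w | v`, p4's `T5AdicCompletionMap`), and the input. -/
structure NSPlace where
  /-- the finite place of `K` -/
  v : HeightOneSpectrum (NumberField.RingOfIntegers K)
  /-- a place of `L` above it -/
  w : HeightOneSpectrum (NumberField.RingOfIntegers L)
  /-- … `w | v` -/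
  [liesOver : w.asIdeal.LiesOver v.asIdeal]
  /-- the local input at the place -/
  X : LocalInput v w

attribute [instance] NSPlace.liesOver

/-- THE PLACES OF THE N SIDE: an index type `ι` with the kind of every place (finite non-split / split / real,
t6-p7's `PlaceKind`) and, behind every place of kind `ns`, a finite non-split place of `K` in `L` with its local
input. -/
structure PlaceFamily (ι : Type*) where
  /-- the kind of each place -/
  kind : ι → PlaceKind
  /-- the finite non-split place with its input behind each place of kind `ns` -/
  ns : ∀ v, kind v = .ns → NSPlace K L

variable {K L}

namespace NSPlace

variable (p : NSPlace K L)

/-- The local sign datum of the statement of record v2 at the place. -/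
def D : LocalSignDatum := p.X.D

/-- The hypotheses of the statement of record v2 at the place. -/
def Hyps : Prop := p.X.Hyps

/-- The coupled local system is solved at the place. -/
theorem exists_localSolution (h : p.Hyps) : ∃ ξ : Fin 4 → p.D.Char, LocalSolution p.D ξ :=
  p.X.exists_localSolution h

end NSPlace

namespace PlaceFamily

variable {ι : Type*} (F : PlaceFamily K L ι)

/-- THE LOCAL SIGN DATUM AT EACH PLACE: the statement of record's datum at a finite non-split place; at a split or
real place (where the sign model does not read it) the toy datum `N5RichToyData.toyLocal`. -/
def D (v : ι) : LocalSignDatum :=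
  if h : F.kind v = .ns then (F.ns v h).D else N5RichToyData.toyLocal

/-- THE PER-PLACE HYPOTHESES of the statements of record v2 at every finite non-split place. -/
def Hyps : Prop := ∀ v (h : F.kind v = .ns), (F.ns v h).Hyps

/-- The datum at a finite non-split place. -/
theorem D_of_ns {v : ι} (h : F.kind v = .ns) : F.D v = (F.ns v h).D := dif_pos h

/-- The coupled local system is solved at every finite non-split place. -/
theorem exists_localSolution (hF : F.Hyps) (v : ι) (h : F.kind v = .ns) :
    ∃ ξ : Fin 4 → (F.D v).Char, LocalSolution (F.D v) ξ := by
  rw [F.D_of_ns h]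
  exact (F.ns v h).exists_localSolution (hF v h)

/-- THE (D-ξ) CHOICE (TIER5 §N5.11): at a finite non-split place a solution of the coupled local system, chosen;
elsewhere the trivial quadruple. -/
def ξ (hF : F.Hyps) (v : ι) : Fin 4 → (F.D v).Char :=
  if h : F.kind v = .ns then (F.exists_localSolution hF v h).choose else fun _ => 1

/-- The chosen characters solve the coupled local system at every finite non-split place. -/
theorem ξ_localSolution (hF : F.Hyps) (v : ι) (h : F.kind v = .ns) : LocalSolution (F.D v) (F.ξ hF v) := by
  unfold ξ
  rw [dif_pos h]
  exact (F.exists_localSolution hF v h).choose_spec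

/-- THE SIGN MODEL OF THE PLACE FAMILY: the local data and the chosen characters at the finite non-split places,
the real-place signs those of the real data `RA` / `RB` of the two sides (t6-p7's `SignModel.ofReal`). -/
def signModel (hF : F.Hyps) (RA RB : ι → RealData) : SignModel ι :=
  SignModel.ofReal F.kind F.D (F.ξ hF) RA RB

/-- `hsol`: THE DATUM'S CHARACTERS SOLVE THE COUPLED LOCAL SYSTEM at every finite non-split place — from the
per-place hypotheses alone. -/
theorem signModel_solves (hF : F.Hyps) (RA RB : ι → RealData) : (F.signModel hF RA RB).Solves :=
  fun v hv => F.ξ_localSolution hF v hv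

/-- `hre`: CONDITION (b) AT THE REAL PLACES, both sides — t6-p7's `realCondB_ofReal` on the sign model (the display
at the real places, the Fock dictionary and the half-line inequalities). -/
theorem signModel_realCondB (hF : F.Hyps) (RA RB : ι → RealData)
    (h35A : ∀ v, F.kind v = .re → BFGYYZ2025_Thm3_5 (RA v).toLocal)
    (h35B : ∀ v, F.kind v = .re → BFGYYZ2025_Thm3_5 (RB v).toLocal)
    (hFA : ∀ v, F.kind v = .re → (RA v).FockDict) (hFB : ∀ v, F.kind v = .re → (RB v).FockDict)
    (hHA : ∀ v, F.kind v = .re → ∀ i, (RA v).HalfLine i)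
    (hHB : ∀ v, F.kind v = .re → ∀ i, (RB v).HalfLine i) :
    (F.signModel hF RA RB).RealCondB :=
  realCondB_ofReal F.kind F.D (F.ξ hF) RA RB h35A h35B hFA hFB hHA hHB

/-- `hsol ∧ hre` on the sign model of the place family. -/
theorem solves_and_realCondB (hF : F.Hyps) (RA RB : ι → RealData)
    (h35A : ∀ v, F.kind v = .re → BFGYYZ2025_Thm3_5 (RA v).toLocal)
    (h35B : ∀ v, F.kind v = .re → BFGYYZ2025_Thm3_5 (RB v).toLocal)
    (hFA : ∀ v, F.kind v = .re → (RA v).FockDict) (hFB : ∀ v, F.kind v = .re → (RB v).FockDict)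
    (hHA : ∀ v, F.kind v = .re → ∀ i, (RA v).HalfLine i)
    (hHB : ∀ v, F.kind v = .re → ∀ i, (RB v).HalfLine i) :
    (F.signModel hF RA RB).Solves ∧ (F.signModel hF RA RB).RealCondB :=
  ⟨F.signModel_solves hF RA RB, F.signModel_realCondB hF RA RB h35A h35B hFA hFB hHA hHB⟩

/-- THE TWO RESIDUAL BINDERS `hsol` / `hre` OF `HCCMOfPublished₂` (ledger rows 183–184) for any rich N5 datum
whose sign model is the sign model of a place family. -/
theorem solves_realCondB_of_eq {G : Type*} [CommGroup G] (R : RichData ι G) (hF : F.Hyps)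
    (RA RB : ι → RealData) (hS : R.S = F.signModel hF RA RB)
    (h35A : ∀ v, F.kind v = .re → BFGYYZ2025_Thm3_5 (RA v).toLocal)
    (h35B : ∀ v, F.kind v = .re → BFGYYZ2025_Thm3_5 (RB v).toLocal)
    (hFA : ∀ v, F.kind v = .re → (RA v).FockDict) (hFB : ∀ v, F.kind v = .re → (RB v).FockDict)
    (hHA : ∀ v, F.kind v = .re → ∀ i, (RA v).HalfLine i)
    (hHB : ∀ v, F.kind v = .re → ∀ i, (RB v).HalfLine i) :
    R.S.Solves ∧ R.S.RealCondB := by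
  rw [hS]
  exact F.solves_and_realCondB hF RA RB h35A h35B hFA hFB hHA hHB

end PlaceFamily

end Family

end

end Summit.Ventures.HodgeRepro2.T6.N5LocalSignModel
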